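import Summits.ValiantsHypothesis.ValiantsHypothesis.Theorems.LacunarySymmetroidMatrixDescartesDoorA26WallBubblingSingleClusterKit
import Summits.ValiantsHypothesis.ValiantsHypothesis.Theorems.LacunarySymmetroidMatrixDescartesDoorA26WallBubblingMultiplicityDescartes
import Summits.ValiantsHypothesis.ValiantsHypothesis.Theorems.LacunarySymmetroidMatrixDescartesDoorA26WallBubblingMixedEncoding

/-!
# `DoorA26` / line `wall_bubbling` — SINGLE-CLUSTER LIFT: a single-cluster accumulation of twenties at an interior exponent vector whose limit
determinant has no zero of order ≥ 3 lies in the twenty-locus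

HONEST FRAMING.  Object-search cell `pub-symmetroid`, crux `Theses.LacunarySymmetroid.DoorA26` (stmt-ValiantsHypothesis-19979; OPEN, typed,
never asserted).  W2 seat val-sym-door-p1 g19; def-free helper for obligation (R) of `Cruxes/DoorA26/Lines/wall_bubbling.lean`.  File #66, head of
the W2 g19 programme: #53–#57 (rank-one touches), #58–#63 (rank-zero nodes), #64 (Laguerre with multiplicity), #65 (single-cluster kit).  Imports #65,
#64, #63.

WHAT IS HERE.  `det_expPencil_eq_expSum_pair` (`ε·det(Σ_l e^{δ_l t} S_l) = expSum (ε·polar(S_k,S_l)) (pairExp δ)`, from `Bubbling.det_sum_smul_fin_two`),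
`card_image_pairExp_le` (≤ 21 pair sums), ★★★ `mem_twentyLocus_of_singleCluster`: `δ` strictly increasing and 2-Sidon (interior of a chamber);
exponent vectors `δseq ν → δ`; member coefficients `a ν → ε·polar(S_k, S_l)` (symmetric letters `S`, `ε = ±1`, some `polar(S_k,S_l) ≠ 0` — the REALISABLE
LIMIT PATTERN that bubbling (B11) delivers); for every `ν` twenty zeros of the window function `expSum (a ν) (pairExp (δseq ν))` in a fixed window
`[−R, R]` (ONE CLUSTER); and the limit determinant `det Σ_l e^{δ_l t} S_l` has NO ZERO OF ORDER ≥ 3 (`F = F′ = 0 ⇒ F″ ≠ 0`) ⇒ `δ ∈ TwentyLocus`.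
PROOF: sort the zeros (`Finset.orderEmbOfFin`), extract an entrywise convergent subsequence (#65 K4), read the limit profile: the fibre of each limit
value `w` is an index interval of length `m(w)` and COALESCENCE (#65 K5) gives `f^{(s)}(w) = 0` for `s < m(w)`, `Σ m = 20`; LAGUERRE WITH MULTIPLICITY
(#64 `sum_order_lt_card_classes`, ≤ 21 classes, some class sum `= H` or `2H ≠ 0` by Sidon + symmetry) makes the profile EXACT (no other zeros, order
exactly `m(w)`), the hypothesis forces `m ≤ 2`, and #63 `mem_twentyLocus_of_doubleZero_profile` lifts.
READING for (R): the single-cluster branch of «T is relatively closed in each open chamber» now reads, in the kernel: a single-cluster accumulation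
point δ⋆ of T inside a chamber IS in T unless the limit determinant has a zero of order ≥ 3.  (The extraction of the single-cluster data — B4–B7/B11 of
the bubbling port with C = 1 — is the line's; the order ≥ 3 profiles are the remaining residual: #50 = one triple zero with all other zeros simple.)
Nothing here bears on `DoorA26`, `DoorA34`, (W)/(M)/(R) as typed, `MatrixDescartes` (18050) or `VP ≠ VNP`; registers unchanged.

[this work].
-/

set_option linter.dupNamespace false

namespace Summit.ValiantsHypothesis.ValiantsHypothesis.Theorems.LacunarySymmetroidMatrixDescartes.WallBubbling

open Finset Filter Topology
open Bubbling (TwentyLocus polar polar_comm polar_self expSum hasDerivAt_expSum Pair pairExp)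

/-- The determinant of a symmetric `2 × 2` exponential pencil, scaled by `ε`, is the 36-member exponential sum of its polar Gram pattern. [folklore] -/
theorem det_expPencil_eq_expSum_pair (δ : Fin 6 → ℝ) (S : Fin 6 → Matrix (Fin 2) (Fin 2) ℝ) (ε : ℝ) (t : ℝ) :
    ε * (∑ l, Real.exp (δ l * t) • S l).det = expSum (fun p : Pair => ε * polar (S p.1) (S p.2)) (pairExp δ) t := by
  rw [Bubbling.det_sum_smul_fin_two]
  simp only [expSum, pairExp, Finset.mul_sum, Fintype.sum_prod_type]
  refine Finset.sum_congr rfl fun k _ => Finset.sum_congr rfl fun l _ => ?_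
  rw [add_mul, Real.exp_add]; ring

/-- At most `21` distinct pair sums. [folklore] -/
theorem card_image_pairExp_le (δ : Fin 6 → ℝ) : (Finset.univ.image (pairExp δ)).card ≤ 21 := by
  classical
  have hsub : Finset.univ.image (pairExp δ) ⊆
      (Finset.univ.filter fun p : Pair => p.1 ≤ p.2).image (pairExp δ) := by
    intro v hv
    obtain ⟨p, -, rfl⟩ := Finset.mem_image.1 hv
    rcases le_total p.1 p.2 with h | h
    · exact Finset.mem_image.2 ⟨p, Finset.mem_filter.2 ⟨Finset.mem_univ _, h⟩, rfl⟩
    · refine Finset.mem_image.2 ⟨(p.2, p.1), Finset.mem_filter.2 ⟨Finset.mem_univ _, h⟩, ?_⟩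
      simp only [pairExp]; ring
  refine (Finset.card_le_card hsub).trans ((Finset.card_image_le).trans ?_)
  decide

/-- **SINGLE-CLUSTER LIFT.**  Let `δ` be strictly increasing and 2-Sidon (an interior point of a chamber).  Suppose twenties accumulate at `δ` in ONE
CLUSTER: exponent vectors `δseq ν → δ`, coefficient patterns `a ν → H` on the 36 members with `H` the polar Gram pattern of symmetric letters `S` up to a
global sign (the realisable limit delivered by bubbling), and for every `ν` twenty distinct zeros of the window function `expSum (a ν) (pairExp (δseq ν))`
in a fixed window `[−R, R]`.  If the limit determinant has NO ZERO OF ORDER ≥ 3, then `δ ∈ TwentyLocus`.  Proof: sort the zeros, extract an entrywise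
convergent subsequence (Bolzano–Weierstrass), read the limit profile (coalescing zeros raise the order: iterated Rolle + continuity), make it exact with
Laguerre-with-multiplicity (#64: total order ≤ 20 on ≤ 21 classes), and feed #63 `mem_twentyLocus_of_doubleZero_profile`. [this work] -/
theorem mem_twentyLocus_of_singleCluster (δ : Fin 6 → ℝ) (hd : StrictMono δ)
    (hSidon : ∀ k l k' l' : Fin 6, δ k + δ l = δ k' + δ l' → (k = k' ∧ l = l') ∨ (k = l' ∧ l = k'))
    (δseq : ℕ → Fin 6 → ℝ) (hδ : ∀ l, Tendsto (fun ν => δseq ν l) atTop (𝓝 (δ l)))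
    (a : ℕ → Pair → ℝ) (S : Fin 6 → Matrix (Fin 2) (Fin 2) ℝ) (hS : ∀ l, (S l).IsSymm) (ε : ℝ) (hε : ε = 1 ∨ ε = -1)
    (ha : ∀ p, Tendsto (fun ν => a ν p) atTop (𝓝 (ε * polar (S p.1) (S p.2))))
    (hH0 : ∃ p : Pair, polar (S p.1) (S p.2) ≠ 0) (R : ℝ)
    (hzeros : ∀ ν, ∃ Z : Finset ℝ, Z.card = 20 ∧ ∀ z ∈ Z, z ∈ Set.Icc (-R) R ∧ expSum (a ν) (pairExp (δseq ν)) z = 0)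
    (hord : ∀ t, (∑ l, Real.exp (δ l * t) • S l).det = 0 →
      deriv (fun t => (∑ l, Real.exp (δ l * t) • S l).det) t = 0 →
      iteratedDeriv 2 (fun t => (∑ l, Real.exp (δ l * t) • S l).det) t ≠ 0) :
    δ ∈ TwentyLocus := by
  classical
  -- the limit sum `f = expSum H X`, `H = ε polar`, `X = pairExp δ`, and `F = det P = ε f`
  set H : Pair → ℝ := fun p => ε * polar (S p.1) (S p.2) with hHdef
  set X : Pair → ℝ := pairExp δ with hX
  set f : ℝ → ℝ := expSum H X with hf
  set F : ℝ → ℝ := fun t => (∑ l, Real.exp (δ l * t) • S l).det with hFdef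
  have hε2 : ε * ε = 1 := by rcases hε with h | h <;> rw [h] <;> norm_num
  have hfF : ∀ t, f t = ε * F t := fun t => by rw [hf, hHdef, hX, ← det_expPencil_eq_expSum_pair]
  have hFf : F = fun t => ε * f t := by
    funext t; rw [hfF, ← mul_assoc, hε2, one_mul]
  have hFexp : F = expSum (fun p => ε * H p) X := by
    rw [hFf]; funext t; simp only [hf, expSum, Finset.mul_sum]; exact Finset.sum_congr rfl fun p _ => by ring
  -- sorted zeros and a convergent subsequence
  choose Z hZcard hZ using hzeros
  let tz : ℕ → Fin 20 → ℝ := fun ν i => (Z ν).orderEmbOfFin (hZcard ν) i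
  have htzR : ∀ ν i, tz ν i ∈ Set.Icc (-R) R := fun ν i => (hZ ν _ ((Z ν).orderEmbOfFin_mem (hZcard ν) i)).1
  have htz0 : ∀ ν i, expSum (a ν) (pairExp (δseq ν)) (tz ν i) = 0 := fun ν i =>
    (hZ ν _ ((Z ν).orderEmbOfFin_mem (hZcard ν) i)).2
  have htzmono : ∀ ν, StrictMono (tz ν) := fun ν => ((Z ν).orderEmbOfFin (hZcard ν)).strictMono
  obtain ⟨φ, ζ, hφ, hζ⟩ := exists_subseq_tendsto_of_bounded tz R htzR
  have hζmono : Monotone ζ := monotone_of_tendsto (fun ν => tz (φ ν)) ζ (fun ν => (htzmono (φ ν)).monotone) hζ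
  -- the reindexed data converge
  have ha' : ∀ p, Tendsto (fun ν => a (φ ν) p) atTop (𝓝 (H p)) := fun p => (ha p).comp hφ.tendsto_atTop
  have hx' : ∀ p, Tendsto (fun ν => pairExp (δseq (φ ν)) p) atTop (𝓝 (X p)) := fun p =>
    ((hδ p.1).comp hφ.tendsto_atTop).add ((hδ p.2).comp hφ.tendsto_atTop)
  -- coalescence ⇒ vanishing orders of `f`
  have hcoal : ∀ i j : Fin 20, i ≤ j → ζ i = ζ j → ∀ s ≤ (j : ℕ) - i, iteratedDeriv s f (ζ i) = 0 := by
    intro i j hij hζij s hs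
    exact iteratedDeriv_eq_zero_of_coalesce ha' hx' (fun ν => tz (φ ν)) (fun ν => htzmono (φ ν))
      (fun ν k => htz0 (φ ν) k) i j hij (ζ i) (hζ i) (by rw [hζij]; exact hζ j) s hs
  -- the profile: distinct values and fibre multiplicities
  set Zset : Finset ℝ := Finset.univ.image ζ with hZset
  set m : ℝ → ℕ := fun w => (Finset.univ.filter fun i : Fin 20 => ζ i = w).card with hm
  have hsum20 : ∑ w ∈ Zset, m w = 20 := by
    rw [hZset, ← Finset.card_eq_sum_card_image ζ Finset.univ, Finset.card_univ, Fintype.card_fin]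
  -- every fibre is an interval of indices, so coalescence applies with `j − i = m w − 1`
  have hvan : ∀ w ∈ Zset, ∀ s < m w, iteratedDeriv s f w = 0 := by
    intro w hw s hs
    set Fw : Finset (Fin 20) := Finset.univ.filter fun i : Fin 20 => ζ i = w with hFw
    have hFne : Fw.Nonempty := by
      obtain ⟨i, -, hi⟩ := Finset.mem_image.1 hw
      exact ⟨i, Finset.mem_filter.2 ⟨Finset.mem_univ _, hi⟩⟩
    set i₀ := Fw.min' hFne with hi₀
    set i₁ := Fw.max' hFne with hi₁
    have hi₀w : ζ i₀ = w := (Finset.mem_filter.1 (Finset.min'_mem Fw hFne)).2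
    have hi₁w : ζ i₁ = w := (Finset.mem_filter.1 (Finset.max'_mem Fw hFne)).2
    have hle : i₀ ≤ i₁ := Finset.min'_le Fw _ (Finset.max'_mem Fw hFne)
    -- the fibre is exactly `Icc i₀ i₁`
    have hFw_eq : Fw = Finset.Icc i₀ i₁ := by
      ext i
      constructor
      · intro hi
        exact Finset.mem_Icc.2 ⟨Finset.min'_le Fw i hi, Finset.le_max' Fw i hi⟩
      · intro hi
        rw [Finset.mem_Icc] at hi
        refine Finset.mem_filter.2 ⟨Finset.mem_univ _, le_antisymm ?_ ?_⟩
        · rw [← hi₁w]; exact hζmono hi.2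
        · rw [← hi₀w]; exact hζmono hi.1
    have hcard : m w = (i₁ : ℕ) + 1 - i₀ := by
      show Fw.card = _; rw [hFw_eq, Fin.card_Icc]
    rw [← hi₀w]
    exact hcoal i₀ i₁ hle (hi₀w.trans hi₁w.symm) s (by rw [hcard] at hs; omega)
  -- the regrouped sum is non-trivial (Sidon + symmetry ⇒ some class sum is `H(i,j)` or `2H(i,j)` ≠ 0)
  have hHsym : ∀ i j, H (i, j) = H (j, i) := fun i j => by simp only [hHdef, polar_comm]
  have hclass : ∃ w, Bubbling.classSum H X w ≠ 0 := by
    obtain ⟨p, hp⟩ := hH0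
    have hHp : H p ≠ 0 := by
      simp only [hHdef]; rcases hε with h | h <;> rw [h] <;> simpa using hp
    refine ⟨X p, ?_⟩
    -- the class of `X p` consists of `p` and its mirror
    have hmem : ∀ q : Pair, X q = X p → q = p ∨ q = (p.2, p.1) := by
      intro q hq
      simp only [hX, pairExp] at hq
      rcases hSidon q.1 q.2 p.1 p.2 hq with ⟨h1, h2⟩ | ⟨h1, h2⟩
      · left; exact Prod.ext h1 h2
      · right; exact Prod.ext h1 h2
    by_cases hdiag : p.1 = p.2
    · -- single member
      have hcls : Bubbling.classSum H X (X p) = H p := by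
        unfold Bubbling.classSum
        rw [Finset.sum_eq_single p]
        · simp
        · intro q _ hq
          rw [if_neg]
          intro h
          rcases hmem q h with h' | h'
          · exact hq h'
          · apply hq; rw [h']; exact Prod.ext hdiag.symm hdiag
        · intro h; exact absurd (Finset.mem_univ p) h
      rw [hcls]; exact hHp
    · have hne : (p.2, p.1) ≠ p := fun h => hdiag (congrArg Prod.fst h).symm
      have hcls : Bubbling.classSum H X (X p) = H p + H (p.2, p.1) := by
        unfold Bubbling.classSum
        rw [← Finset.sum_subset (Finset.subset_univ ({p, (p.2, p.1)} : Finset Pair))]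
        · rw [Finset.sum_pair hne.symm]
          simp [hX, pairExp, add_comm]
        · intro q _ hq
          rw [if_neg]
          intro h
          rcases hmem q h with h' | h'
          · exact hq (by rw [h']; simp)
          · exact hq (by rw [h']; simp)
      rw [hcls, show H (p.2, p.1) = H p from (hHsym p.1 p.2).symm]
      intro h; apply hHp; linarith
  have hbound : ∀ (Z' : Finset ℝ) (m' : ℝ → ℕ), (∀ z ∈ Z', ∀ k < m' z, iteratedDeriv k f z = 0) → ∑ z ∈ Z', m' z ≤ 20 := by
    intro Z' m' h
    have := sum_order_lt_card_classes H X hclass Z' m' h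
    have := card_image_pairExp_le δ
    rw [← hX] at this
    omega
  -- no other zeros
  have hzero_iff : ∀ t, f t = 0 ↔ t ∈ Zset := by
    intro t
    constructor
    · intro ht
      by_contra hnot
      have := hbound (insert t Zset) (fun w => if w = t then 1 else m w) (fun z hz k hk => by
        by_cases hzt : z = t
        · subst hzt
          have hk1 : k < 1 := by simpa using hk
          have : k = 0 := by omega
          subst this; rw [iteratedDeriv_zero]; exact ht
        · rw [if_neg hzt] at hk
          rcases Finset.mem_insert.1 hz with h | hz
          · exact absurd h hzt
          · exact hvan z hz k hk)
      rw [Finset.sum_insert hnot, if_pos rfl] at this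
      have h2 : ∑ w ∈ Zset, (if w = t then 1 else m w) = ∑ w ∈ Zset, m w :=
        Finset.sum_congr rfl fun w hw => by rw [if_neg (fun h => hnot (by rw [← h]; exact hw))]
      rw [h2, hsum20] at this
      omega
    · intro ht
      have h1 : 1 ≤ m t := by
        obtain ⟨i, -, hi⟩ := Finset.mem_image.1 ht
        exact Finset.card_pos.2 ⟨i, Finset.mem_filter.2 ⟨Finset.mem_univ _, hi⟩⟩
      have := hvan t ht 0 h1
      rwa [iteratedDeriv_zero] at this
  -- exact orders
  have hexact : ∀ w ∈ Zset, iteratedDeriv (m w) f w ≠ 0 := by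
    intro w hw hzero
    have := hbound Zset (fun z => if z = w then m w + 1 else m z) (fun z hz k hk => by
      by_cases hzw : z = w
      · subst hzw
        rw [if_pos rfl] at hk
        rcases Nat.lt_succ_iff_lt_or_eq.1 hk with h | h
        · exact hvan z hz k h
        · rw [h]; exact hzero
      · simp only [if_neg hzw] at hk
        exact hvan z hz k hk)
    have h2 : ∑ z ∈ Zset, (if z = w then m w + 1 else m z) = ∑ z ∈ Zset, m z + 1 := by
      rw [← Finset.sum_erase_add _ _ hw, ← Finset.sum_erase_add _ _ hw, if_pos rfl]
      have : ∑ z ∈ Zset.erase w, (if z = w then m w + 1 else m z) = ∑ z ∈ Zset.erase w, m z :=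
        Finset.sum_congr rfl fun z hz => by rw [if_neg (Finset.ne_of_mem_erase hz)]
      rw [this]; ring
    rw [h2, hsum20] at this
    omega
  -- orders are 1 or 2
  have hm12 : ∀ w ∈ Zset, m w = 1 ∨ m w = 2 := by
    intro w hw
    have h1 : 1 ≤ m w := by
      obtain ⟨i, -, hi⟩ := Finset.mem_image.1 hw
      exact Finset.card_pos.2 ⟨i, Finset.mem_filter.2 ⟨Finset.mem_univ _, hi⟩⟩
    by_contra hnot
    have h3 : 3 ≤ m w := by omega
    have e0 := hvan w hw 0 (by omega)
    have e1 := hvan w hw 1 (by omega)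
    have e2 := hvan w hw 2 (by omega)
    rw [iteratedDeriv_zero] at e0
    rw [iteratedDeriv_one] at e1
    -- transfer to `F = ε f`
    have hF0 : F w = 0 := by show (∑ l, Real.exp (δ l * w) • S l).det = 0; rw [show (∑ l, Real.exp (δ l * w) • S l).det = F w from rfl, hFf]; simp [e0]
    have hF1 : deriv F w = 0 := by
      rw [hFf, deriv_const_mul _ ((hasDerivAt_expSum H X w).differentiableAt), e1, mul_zero]
    have hF2 : iteratedDeriv 2 F w = 0 := by
      rw [hFexp, iteratedDeriv_expSum]
      have : iteratedDeriv 2 f w = expSum (fun p => H p * X p ^ 2) X w := by rw [hf, iteratedDeriv_expSum]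
      rw [this] at e2
      simp only [expSum] at e2 ⊢
      rw [show (∑ i, ε * H i * X i ^ 2 * Real.exp (X i * w)) = ε * ∑ i, H i * X i ^ 2 * Real.exp (X i * w) from by
        rw [Finset.mul_sum]; exact Finset.sum_congr rfl fun i _ => by ring, e2, mul_zero]
    exact hord w hF0 hF1 hF2
  -- the inputs of #63
  set r := Zset.card with hr
  let z : Fin r ↪o ℝ := Zset.orderEmbOfFin rfl
  set D : Finset (Fin r) := Finset.univ.filter fun i => m (z i) = 2 with hD
  have hzmem : ∀ i, (z i : ℝ) ∈ Zset := fun i => Zset.orderEmbOfFin_mem rfl i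
  have hcount : r + D.card = 20 := by
    -- Σ m over Zset = Σ_i m (z i) = #{m=1} + 2 #{m=2} = r + |D|
    have h1 : ∑ w ∈ Zset, m w = ∑ i : Fin r, m (z i) := by
      conv_lhs => rw [← Finset.map_orderEmbOfFin_univ Zset rfl]
      rw [Finset.sum_map]
      rfl
    have h2 : ∀ i : Fin r, m (z i) = 1 + (if m (z i) = 2 then 1 else 0) := by
      intro i
      rcases hm12 _ (hzmem i) with h | h
      · rw [h]; norm_num
      · rw [h]; norm_num
    have h3 : ∑ i : Fin r, m (z i) = r + D.card := by
      rw [Finset.sum_congr rfl (fun i _ => h2 i), Finset.sum_add_distrib, Finset.sum_const, Finset.card_univ,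
        Fintype.card_fin, smul_eq_mul, mul_one, ← Finset.sum_filter, Finset.sum_const, smul_eq_mul, mul_one]
    omega
  refine mem_twentyLocus_of_doubleZero_profile δ hd S hS z z.strictMono D hcount ?_ ?_ ?_
  · -- zeros of `F` = range of `z`
    intro t
    rw [show (∑ l, Real.exp (δ l * t) • S l).det = F t from rfl]
    have : F t = 0 ↔ f t = 0 := by
      rw [hfF]; constructor
      · intro h; rw [h, mul_zero]
      · intro h; rcases mul_eq_zero.1 h with h' | h'
        · rcases hε with e | e <;> rw [e] at h' <;> norm_num at h'
        · exact h'
    rw [this, hzero_iff]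
    constructor
    · intro ht
      obtain ⟨i, hi⟩ : ∃ i, z i = t := by
        have : t ∈ Set.range z := by rw [Finset.range_orderEmbOfFin]; exact ht
        exact this
      exact ⟨i, hi⟩
    · rintro ⟨i, rfl⟩; exact hzmem i
  · -- simple zeros
    intro i hi
    have hm1 : m (z i) = 1 := by
      rcases hm12 _ (hzmem i) with h | h
      · exact h
      · exact absurd (show i ∈ D from by rw [hD]; exact Finset.mem_filter.2 ⟨Finset.mem_univ i, h⟩) hi
    have hne := hexact _ (hzmem i)
    rw [hm1, iteratedDeriv_one] at hne
    show deriv F (z i) ≠ 0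
    rw [hFf, deriv_const_mul _ ((hasDerivAt_expSum H X _).differentiableAt)]
    exact mul_ne_zero (by rcases hε with e | e <;> rw [e] <;> norm_num) hne
  · -- double zeros
    intro i hi
    have hm2 : m (z i) = 2 := (Finset.mem_filter.1 hi).2
    have e1 := hvan _ (hzmem i) 1 (by rw [hm2]; norm_num)
    have hne := hexact _ (hzmem i)
    rw [hm2] at hne
    rw [iteratedDeriv_one] at e1
    refine ⟨?_, ?_⟩
    · show deriv F (z i) = 0
      rw [hFf, deriv_const_mul _ ((hasDerivAt_expSum H X _).differentiableAt), e1, mul_zero]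
    · show iteratedDeriv 2 F (z i) ≠ 0
      rw [hFexp, iteratedDeriv_expSum]
      have : iteratedDeriv 2 f (z i) = expSum (fun p => H p * X p ^ 2) X (z i) := by rw [hf, iteratedDeriv_expSum]
      rw [this] at hne
      simp only [expSum] at hne ⊢
      rw [show (∑ p, ε * H p * X p ^ 2 * Real.exp (X p * z i)) = ε * ∑ p, H p * X p ^ 2 * Real.exp (X p * z i) from by
        rw [Finset.mul_sum]; exact Finset.sum_congr rfl fun p _ => by ring]
      exact mul_ne_zero (by rcases hε with e | e <;> rw [e] <;> norm_num) hne

end Summit.ValiantsHypothesis.ValiantsHypothesis.Theorems.LacunarySymmetroidMatrixDescartes.WallBubbling
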